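import Mathlib
import Summits.KontsevichZagierPeriods.KontsevichZagierPeriods.Theorems.SoloInformedHesseChart
import Literature.NumberTheory.Transcendental.KZCalculus
import Literature.NumberTheory.Transcendental.KZMellinFibres
import Literature.NumberTheory.Transcendental.KZSemialgebraicComplex
import Literature.NumberTheory.Transcendental.SemialgebraicMapsProofs
import HarnessLib
import HarnessLib.Audit

/-!
# SoloInformed — Gauss triplication by the moves, IV: rule (2) along the tangential chart

One Kontsevich–Zagier move: for every real-algebraic `a` and rational `s`, a representation
pinned as `[C₀, a·(xy(1−x−y))^{s−1}]` on the Weyl chamber is equivalent to every representation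
pinned as `[B₃′, (a/2)·(xy(1−x−y))^{s−1}]` on the outer region (`soloInformed_hesseMove`), and the
latter EXISTS as soon as the former does (`soloInformed_exists_outerRep`: absolute convergence is
transported through `Ψ` by the Jacobian criterion). The integrand identity is `F∘Ψ = F` and
`|det DΨ| = 2` (`SoloInformedHesseTangential`, `SoloInformedHesseChart`).

Residency `solo-KontsevichZagierPeriods-informed` (s71); paper §7 (c6)(x).
References: Kontsevich–Zagier, *Periods* (2001), §1.2 rule (2).
-/

noncomputable section

open MeasureTheory Set Filter
namespace Summit.KontsevichZagierPeriods.KontsevichZagierPeriods.Theorems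

open Literature.NumberTheory.Transcendental Literature.NumberTheory.Transcendental.KZ
open Literature.ModelTheory.ExponentialFields

/-- The pencil kernel `a · (xy(1−x−y))^{e}` on `ℝ²`. [this work] -/
def soloInformedHesseKernel (a e : ℝ) (w : Fin 2 → ℝ) : ℝ := a * (w 0 * w 1 * (1 - w 0 - w 1)) ^ e

/-- On `B₃′`, `F = xy(1−x−y) > 0`. [this work] -/
theorem soloInformed_hesseF_pos_of_B3 {w : Fin 2 → ℝ} (hw : w ∈ soloInformedB3) :
    0 < w 0 * w 1 * (1 - w 0 - w 1) := by
  obtain ⟨h0, h1, -⟩ := hw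
  have : 0 < w 0 * w 1 := mul_pos_of_neg_of_neg h0 h1
  nlinarith

/-- The pencil kernel with real-algebraic `a` and rational exponent is `ℚ`-semialgebraic on `B₃′`
(Euler–Mellin, one factor). [this work] -/
theorem soloInformed_isSemialgebraicFunOn_hesseKernel_B3 {a : ℝ} (ha : IsAlgebraic ℚ a) (e : ℚ) :
    IsSemialgebraicFunOn ℚ soloInformedB3 (soloInformedHesseKernel a e) := by
  have hB := soloInformed_isSemialgebraic_B3
  have hm := isSemialgebraicFunOn_mellinIntegrand hB
    ![(MvPolynomial.X 0 * MvPolynomial.X 1 * (1 - MvPolynomial.X 0 - MvPolynomial.X 1) : MvPolynomial (Fin 2) ℚ)]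
    ![e] 1 (fun w hw k => by
      fin_cases k
      simpa using soloInformed_hesseF_pos_of_B3 hw)
  refine (IsSemialgebraicFunOn.mul_holds (isSemialgebraicFunOn_const_of_isAlgebraic hB ha) hm).congr
    fun w _ => ?_
  simp [soloInformedHesseKernel, mellinIntegrand_apply]

/-- **The outer representation exists**: if `[C₀, a·F^{s−1}]` is a representation (absolutely
convergent), so is `[B₃′, (a/2)·F^{s−1}]`. [this work] -/
theorem soloInformed_exists_outerRep {a : ℝ} (ha : IsAlgebraic ℚ a) (s : ℚ) (A : IntegralRep 2)
    (hAd : A.domain = soloInformedC0)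
    (hAi : EqOn A.integrand (soloInformedHesseKernel a ((s:ℝ) - 1)) A.domain) :
    ∃ T : IntegralRep 2, T.domain = soloInformedB3 ∧
      T.integrand = soloInformedHesseKernel (a / 2) ((s:ℝ) - 1) := by
  obtain ⟨hsa, hderiv, hinj, himage, hdet⟩ := soloInformed_hesseChart
  set K := soloInformedHesseKernel (a / 2) ((s:ℝ) - 1) with hK
  have hbox : IntegrableOn (fun z => |(soloInformedTanD z).det| • K (soloInformedTan z)) soloInformedC0 := by
    have h1 : IntegrableOn A.integrand soloInformedC0 := hAd ▸ A.integrableOn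
    refine h1.congr_fun (fun z hz => ?_) soloInformed_measurableSet_C0
    obtain ⟨hx, hxz, hzy⟩ := hz
    have hd : z 0 - z 1 ≠ 0 := by intro h; linarith
    have hm : z 0 + 2 * z 1 - 1 ≠ 0 := by intro h; linarith
    have hn : 2 * z 0 + z 1 - 1 ≠ 0 := by intro h; linarith
    have hF := soloInformed_hesseF_tan hd hm hn
    unfold soloInformedHesseF at hF
    rw [hAi (by rw [hAd]; exact ⟨hx, hxz, hzy⟩), hdet z ⟨hx, hxz, hzy⟩, smul_eq_mul, hK]
    simp only [soloInformedHesseKernel, soloInformedTan_zero, soloInformedTan_one, hF]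
    ring
  have hint : IntegrableOn K soloInformedB3 := by
    rw [← himage, integrableOn_image_iff_integrableOn_abs_det_fderiv_smul volume
      soloInformed_measurableSet_C0 (fun x hx => (hderiv x hx).hasFDerivWithinAt) hinj]
    exact hbox
  have ha2' : IsAlgebraic ℚ (a / 2) := by
    rw [div_eq_mul_inv]
    exact ha.mul (isAlgebraic_nat 2).inv
  have hsf : IsSemialgebraicFunOn ℚ soloInformedB3 K := by
    have := soloInformed_isSemialgebraicFunOn_hesseKernel_B3 ha2' (s - 1)
    simpa [hK, Rat.cast_sub, Rat.cast_one] using this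
  exact ⟨⟨_, _, soloInformed_isSemialgebraic_B3, hsf, hint⟩, rfl, rfl⟩

/-- **Rule (2) along the tangential chart**: `[C₀, a·F^{e}] ∼ [B₃′, (a/2)·F^{e}]` for every pair of
representations so pinned (`F∘Ψ = F`, `|det DΨ| = 2`). [this work] -/
theorem soloInformed_hesseMove (a e : ℝ) (A T : IntegralRep 2) (hAd : A.domain = soloInformedC0)
    (hAi : EqOn A.integrand (soloInformedHesseKernel a e) A.domain)
    (hTd : T.domain = soloInformedB3) (hTi : EqOn T.integrand (soloInformedHesseKernel (a / 2) e) T.domain) :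
    Equivalent A T := by
  obtain ⟨hsa, hderiv, hinj, himage, hdet⟩ := soloInformed_hesseChart
  refine changeOfVariablesRel_subset_relations
    ⟨2, A, T, soloInformedTan, soloInformedTanD, by rw [hAd]; exact hsa,
      fun x hx => (hderiv x (by rw [hAd] at hx; exact hx)).hasFDerivWithinAt,
      by rw [hAd]; exact hinj, by rw [hAd, hTd, himage], fun z hz => ?_, rfl⟩
  have hz' : z ∈ soloInformedC0 := by rw [hAd] at hz; exact hz
  have hTz : soloInformedTan z ∈ T.domain := by
    rw [hTd, ← himage]; exact mem_image_of_mem _ hz'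
  obtain ⟨hx, hxz, hzy⟩ := hz'
  have hd : z 0 - z 1 ≠ 0 := by intro h; linarith
  have hm : z 0 + 2 * z 1 - 1 ≠ 0 := by intro h; linarith
  have hn : 2 * z 0 + z 1 - 1 ≠ 0 := by intro h; linarith
  have hF := soloInformed_hesseF_tan hd hm hn
  unfold soloInformedHesseF at hF
  rw [hAi hz, hTi hTz, hdet z ⟨hx, hxz, hzy⟩]
  simp only [soloInformedHesseKernel, soloInformedTan_zero, soloInformedTan_one, hF]
  ring

end Summit.KontsevichZagierPeriods.KontsevichZagierPeriods.Theorems
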